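import Mathlib
import Summits.ResolutionOfSingularities.ResolutionOfSingularities.Theorems.WeightedInvariantDatumToEmbeddedQuotientSingularitiesGraded
import HarnessLib

/-!
# The grading of a localization `A[1/f]` at a degree-zero element

Topic: `Summits/ResolutionOfSingularities/ResolutionOfSingularities/Theorems`. Helper file of the
stub `stub_quotientSingularities_of_regular` of the line `Sketch` of the crux
`Theses.WeightedInvariant.DatumToEmbedded` (statement `stmt-ResolutionOfSingularities-0572`).

For a graded algebra `A = ⨁ᵢ Aᵢ` (Mathlib `GradedAlgebra 𝒜`) and `f ∈ A₀`, every localization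
`L` of `A` away from `f` is graded by `Lᵢ := {x | fⁿ x ∈ Aᵢ for some n} = Aᵢ[1/f]`
(`awayPiece`; Bourbaki, *Algèbre commutative* II §2 no. 9 / EGA II 2.2: localization of a graded
ring at a homogeneous element of degree `0` — geometrically, restricting a torus action to the
invariant basic open `D(f)`): `nonempty_gradedAlgebra_awayPiece`, and the degree-`0` part `L₀` is the localization of `A₀`
away from `f` (`isLocalization_awayPiece_zero`).

Only Mathlib and the sibling file `…QuotientSingularitiesGraded` (`decompose_sum_of_mem`) are used.
-/

-- the summit namespace repeats `ResolutionOfSingularities` by design (mandated namespace)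
set_option linter.dupNamespace false

namespace Summit.ResolutionOfSingularities.ResolutionOfSingularities.Theorems.DatumToEmbedded.QuotientSingularities

open DirectSum

section GradedLocalization

variable {ι R A : Type*} [DecidableEq ι] [AddMonoid ι] [CommRing R] [CommRing A] [Algebra R A]
  (𝒜 : ι → Submodule R A) [GradedAlgebra 𝒜] {f : A} (hf : f ∈ 𝒜 0)
  (L : Type*) [CommRing L] [Algebra A L] [Algebra R L] [IsScalarTower R A L]
  [IsLocalization.Away f L]

include hf in
omit [DecidableEq ι] in
/-- Powers of a degree-`0` element have degree `0`. [folklore] -/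
theorem pow_mem_zero [SetLike.GradedMonoid 𝒜] (n : ℕ) : f ^ n ∈ 𝒜 0 := by
  simpa using SetLike.pow_mem_graded n hf

omit [DecidableEq ι] [GradedAlgebra 𝒜] in
variable {𝒜} in
/-- Multiplying by a degree-`0` element preserves the degree. [folklore] -/
theorem mul_mem_of_mem_zero [SetLike.GradedMonoid 𝒜] {b a : A} {i : ι} (hb : b ∈ 𝒜 0)
    (ha : a ∈ 𝒜 i) : b * a ∈ 𝒜 i := by
  simpa using SetLike.mul_mem_graded hb ha

/-- The **graded pieces of the localization away from a degree-`0` element `f`**: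
`Lᵢ = {x | fⁿ • x` is the image of an element of `Aᵢ}`. [folklore] -/
def awayPiece (i : ι) : Submodule R L where
  carrier := {x | ∃ n : ℕ, ∃ a ∈ 𝒜 i, algebraMap A L f ^ n * x = algebraMap A L a}
  zero_mem' := ⟨0, 0, zero_mem _, by simp⟩
  add_mem' := by
    rintro x y ⟨n, a, ha, hx⟩ ⟨m, b, hb, hy⟩
    refine ⟨n + m, f ^ m * a + f ^ n * b,
      add_mem (mul_mem_of_mem_zero (pow_mem_zero 𝒜 hf m) ha)
        (mul_mem_of_mem_zero (pow_mem_zero 𝒜 hf n) hb), ?_⟩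
    rw [map_add, map_mul, map_mul, map_pow, map_pow, ← hx, ← hy]
    ring
  smul_mem' := by
    rintro c x ⟨n, a, ha, hx⟩
    refine ⟨n, c • a, Submodule.smul_mem _ c ha, ?_⟩
    rw [Algebra.smul_def, Algebra.smul_def, IsScalarTower.algebraMap_apply R A L, map_mul, ← hx]
    ring

variable {𝒜 L} in
omit [IsLocalization.Away f L] in
/-- Membership in a graded piece of the localization. [folklore] -/
theorem mem_awayPiece_iff {i : ι} {x : L} :
    x ∈ awayPiece 𝒜 hf L i ↔ ∃ n : ℕ, ∃ a ∈ 𝒜 i, algebraMap A L f ^ n * x = algebraMap A L a :=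
  Iff.rfl

variable {𝒜 L} in
omit [IsLocalization.Away f L] in
/-- The image of a homogeneous element is homogeneous of the same degree. [folklore] -/
theorem algebraMap_mem_awayPiece {i : ι} {a : A} (ha : a ∈ 𝒜 i) :
    algebraMap A L a ∈ awayPiece 𝒜 hf L i :=
  ⟨0, a, ha, by simp⟩

/-- The pieces of the localization form a graded monoid. [folklore] -/
instance gradedMonoid_awayPiece : SetLike.GradedMonoid (awayPiece 𝒜 hf L) where
  one_mem := ⟨0, 1, SetLike.one_mem_graded 𝒜, by simp⟩
  mul_mem := by
    rintro i j x y ⟨n, a, ha, hx⟩ ⟨m, b, hb, hy⟩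
    refine ⟨n + m, a * b, SetLike.mul_mem_graded ha hb, ?_⟩
    rw [map_mul, ← hx, ← hy]
    ring

/-- The pieces of the localization span: `x = a/fⁿ = ∑ᵢ aᵢ/fⁿ`. [folklore] -/
theorem iSup_awayPiece_eq_top : ⨆ i, awayPiece 𝒜 hf L i = ⊤ := by
  classical
  rw [eq_top_iff]
  rintro x -
  obtain ⟨⟨a, s⟩, hx⟩ := IsLocalization.surj (Submonoid.powers f) x
  obtain ⟨n, hn⟩ := (Submonoid.mem_powers_iff _ _).1 s.2
  obtain ⟨u, hu⟩ : ∃ u : L, algebraMap A L f * u = 1 :=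
    ⟨IsLocalization.Away.invSelf f, IsLocalization.Away.mul_invSelf f⟩
  have hx' : x = algebraMap A L a * u ^ n := by
    have h1 : algebraMap A L f ^ n * u ^ n = 1 := by rw [← mul_pow, hu, one_pow]
    calc x = x * (algebraMap A L f ^ n * u ^ n) := by rw [h1, mul_one]
      _ = algebraMap A L a * u ^ n := by rw [← mul_assoc, ← map_pow, hn, hx]
  rw [hx', ← sum_support_decompose 𝒜 a, map_sum, Finset.sum_mul]
  refine Submodule.sum_mem _ fun i _ => Submodule.mem_iSup_of_mem i
    ⟨n, decompose 𝒜 a i, SetLike.coe_mem _, ?_⟩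
  rw [mul_left_comm, ← mul_pow, hu, one_pow, mul_one]

/-- The pieces of the localization are independent: a relation `∑ᵢ xᵢ = 0` with `xᵢ ∈ Lᵢ`
becomes, after clearing denominators, a relation `fᵐ ∑ᵢ aᵢ = 0` in `A` between homogeneous
elements of distinct degrees. [folklore] -/
theorem iSupIndep_awayPiece : iSupIndep (awayPiece 𝒜 hf L) := by
  classical
  rw [iSupIndep_iff_finsetSum_eq_zero_imp_eq_zero]
  intro s v hv hsum
  choose! n a ha hva using fun i (hi : i ∈ s) => (mem_awayPiece_iff hf).1 (hv i hi)
  -- common denominator `f ^ N`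
  set N := ∑ i ∈ s, n i with hN
  have hle : ∀ i ∈ s, n i ≤ N := fun i hi =>
    Finset.single_le_sum (f := n) (fun _ _ => Nat.zero_le _) hi
  have hva' : ∀ i ∈ s, algebraMap A L f ^ N * v i = algebraMap A L (f ^ (N - n i) * a i) :=
    fun i hi => by
      rw [map_mul, map_pow, ← hva i hi, ← mul_assoc, ← pow_add, Nat.sub_add_cancel (hle i hi)]
  -- the relation in `A`, after multiplying by some `f ^ m`
  have hrel : algebraMap A L (∑ i ∈ s, f ^ (N - n i) * a i) = 0 := by
    rw [map_sum, ← Finset.sum_congr rfl hva', ← Finset.mul_sum, hsum, mul_zero]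
  obtain ⟨⟨c, hc⟩, hc0⟩ := (IsLocalization.map_eq_zero_iff (Submonoid.powers f) L _).1 hrel
  obtain ⟨m, rfl⟩ := (Submonoid.mem_powers_iff _ _).1 hc
  rw [Finset.mul_sum] at hc0
  have hindep := (iSupIndep_iff_finsetSum_eq_zero_imp_eq_zero 𝒜).1
    (Decomposition.isInternal 𝒜).submodule_iSupIndep s (fun i => f ^ m * (f ^ (N - n i) * a i))
    (fun i hi => mul_mem_of_mem_zero (pow_mem_zero 𝒜 hf m)
      (mul_mem_of_mem_zero (pow_mem_zero 𝒜 hf _) (ha i hi))) hc0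
  -- back in `L`: `f ^ (m + N) * v i = 0`, and `f` is a unit
  intro i hi
  have h1 : algebraMap A L f ^ (m + N) * v i = 0 := by
    rw [pow_add, mul_assoc, hva' i hi, ← map_pow, ← map_mul, hindep i hi, map_zero]
  exact (IsUnit.mul_right_eq_zero ((IsLocalization.Away.algebraMap_isUnit f).pow _)).1 h1

/-- **The localization of a graded algebra away from a degree-`0` element is graded** by the
pieces `Aᵢ[1/f]`. [folklore] -/
theorem nonempty_gradedAlgebra_awayPiece : Nonempty (GradedAlgebra (awayPiece 𝒜 hf L)) :=
  have hint : DirectSum.IsInternal (awayPiece 𝒜 hf L) :=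
    (DirectSum.isInternal_submodule_iff_iSupIndep_and_iSup_eq_top _).2
      ⟨iSupIndep_awayPiece 𝒜 hf L, iSup_awayPiece_eq_top 𝒜 hf L⟩
  ⟨{ (gradedMonoid_awayPiece 𝒜 hf L) with toDecomposition := hint.chooseDecomposition }⟩

/-! ### The degree-zero part -/

/-- The localization map restricted to degree `0`, `A₀ → L₀`. [folklore] -/
def awayPieceZeroHom : 𝒜 0 →+* awayPiece 𝒜 hf L 0 where
  toFun a := ⟨algebraMap A L a, algebraMap_mem_awayPiece hf a.2⟩
  map_one' := Subtype.ext (by simp)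
  map_mul' a b := Subtype.ext (by simp)
  map_zero' := Subtype.ext (by simp)
  map_add' a b := Subtype.ext (by simp)

/-- `L₀` as an `A₀`-algebra. [folklore] -/
@[reducible] noncomputable def awayPieceZeroAlgebra : Algebra (𝒜 0) (awayPiece 𝒜 hf L 0) :=
  (awayPieceZeroHom 𝒜 hf L).toAlgebra

/-- **The degree-`0` part of `A[1/f]` is `A₀[1/f]`** (`f ∈ A₀`). [folklore] -/
theorem isLocalization_awayPiece_zero :
    letI := awayPieceZeroAlgebra 𝒜 hf L
    IsLocalization.Away (⟨f, hf⟩ : 𝒜 0) (awayPiece 𝒜 hf L 0) := by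
  letI := awayPieceZeroAlgebra 𝒜 hf L
  have halg : ∀ a : 𝒜 0, (algebraMap (𝒜 0) (awayPiece 𝒜 hf L 0) a : L) = algebraMap A L a :=
    fun a => rfl
  obtain ⟨u, hu⟩ : ∃ u : L, algebraMap A L f * u = 1 :=
    ⟨IsLocalization.Away.invSelf f, IsLocalization.Away.mul_invSelf f⟩
  have humem : u ∈ awayPiece 𝒜 hf L 0 := ⟨1, 1, SetLike.one_mem_graded 𝒜, by simpa using hu⟩
  refine { map_units := ?_, surj := ?_, exists_of_eq := ?_ }
  · rintro ⟨y, hy⟩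
    obtain ⟨n, rfl⟩ := (Submonoid.mem_powers_iff _ _).1 hy
    rw [map_pow]
    refine IsUnit.pow n ⟨⟨_, ⟨u, humem⟩, Subtype.ext ?_, Subtype.ext ?_⟩, rfl⟩
    · exact hu
    · rw [mul_comm] at hu; exact hu
  · rintro ⟨z, n, a, ha, hz⟩
    refine ⟨⟨⟨a, ha⟩, ⟨⟨f, hf⟩ ^ n, n, rfl⟩⟩, Subtype.ext ?_⟩
    change z * (algebraMap (𝒜 0) (awayPiece 𝒜 hf L 0) (⟨f, hf⟩ ^ n) : L) = algebraMap A L a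
    rw [map_pow]
    change z * (algebraMap A L f) ^ n = algebraMap A L a
    rw [mul_comm, hz]
  · rintro ⟨a, ha⟩ ⟨b, hb⟩ hab
    have hab' : algebraMap A L a = algebraMap A L b := congrArg Subtype.val hab
    obtain ⟨⟨c, hc⟩, hc'⟩ := (IsLocalization.eq_iff_exists (Submonoid.powers f) L).1 hab'
    obtain ⟨m, rfl⟩ := (Submonoid.mem_powers_iff _ _).1 hc
    refine ⟨⟨⟨f, hf⟩ ^ m, m, rfl⟩, Subtype.ext ?_⟩
    simpa using hc'

end GradedLocalization

/-! ## Registered form -/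

/-- **Registered sub-goal `stub_qs_gradedLocalization`** of the crux (helper of the stub
`stub_quotientSingularities_of_regular`): the localization of a graded algebra away from a
degree-`0` element is graded. [folklore] -/
theorem stub_qs_gradedLocalization :
    ∀ {ι R A : Type} [DecidableEq ι] [AddMonoid ι] [CommRing R] [CommRing A] [Algebra R A]
      (𝒜 : ι → Submodule R A) [GradedAlgebra 𝒜] {f : A} (hf : f ∈ 𝒜 0) (L : Type) [CommRing L]
      [Algebra A L] [Algebra R L] [IsScalarTower R A L] [IsLocalization.Away f L],
      Nonempty (GradedAlgebra
        (Summit.ResolutionOfSingularities.ResolutionOfSingularities.Theorems.DatumToEmbedded.QuotientSingularities.awayPiece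
          𝒜 hf L)) :=
  fun 𝒜 _ _ hf L _ _ _ _ _ => nonempty_gradedAlgebra_awayPiece 𝒜 hf L

end Summit.ResolutionOfSingularities.ResolutionOfSingularities.Theorems.DatumToEmbedded.QuotientSingularities
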